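import Literature.Geometry.Riemannian.TubeChristoffelNearAxis
import Literature.Geometry.Riemannian.TubeMetricNearAxis
import Literature.Geometry.Riemannian.SphereChristoffelBound
import Literature.Geometry.Riemannian.CurveTubeEmbedding
import Literature.Geometry.Riemannian.ClopenSubmanifoldMetric
import Literature.Geometry.Lorentzian.IsometryProofs
import HarnessLib

/-!
# The round model of a thin tube around an embedded arc (Weinstein 1968, steps (1)–(2))

Topic `Geometry/Riemannian`. Let `(M, g)` be a Riemannian manifold with complete Levi-Civita
connection, `c : ℝ → M` a unit-speed `C^∞` curve, injective on `[-1, 1]`, with a `g`-orthonormal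
relatively parallel adapted frame `e` (`e t ε₀ = ċ t`), geodesic curvature `≤ K` on `[-1, 1]`, and
`Φ(v) = exp_{c(x₁)}(e(x₁) v^⊥)` (`x₁ = ⟪ε₀, v⟫`) the tube map (`CurveTubeMap.lean`). We produce
the **round model** of a thin solid tube around `c([-1/2, 1/2])` consumed by Weinstein's surgery
(`WeinsteinSurgeryCriterion.exists_metric_two_le_multiplicity_of_surgery`): a linear rounding
`A = 2⟪ε₀, ·⟫ε₀ + ρ⁻¹ (· )^⊥` of the ellipsoid with semi-axes `1/2, ρ`, the open set
`U = A(open solid tube)` containing the closed ball of radius `5/4`, the chart metric `g_U` with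
components `G_U = (Φ ∘ A⁻¹)^* g`, and the two estimates on the unit sphere of `U`:

* (normalisation) `1 ≤ q(p) = G_U(N, N)`, `N = G_U(p)⁻¹⟪p, ·⟫`;
* (Christoffel bound) `⟪p, Γ_p(X)(X)⟫ ≤ λ √q(p) G_U(X, X)` with `0 ≤ λ ≤ 5K + 3`.

Ingredients: injectivity of `Φ` on a solid tube (`CurveTubeEmbedding.exists_tube_injOn_tubeMap`),
the near-axis Christoffel bound `|⟪w, Γ_x(X)(X)⟫| ≤ (2K + 1)‖X‖²‖w‖`
(`TubeChristoffelNearAxis.exists_abs_inner_christoffel_tube_le`) and metric comparison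
`(1 ± 1/2)‖Y‖²` (`TubeMetricNearAxis.exists_tube_metric_near_inner`) in tube coordinates, transported
to the round picture by `SphereChristoffelBound.sphere_inner_christoffel_le`; the tube radius `ρ`
is chosen below all the thresholds. This is the geometric content of Weinstein's step (2) ("thicken
the arc to a disk `D` whose boundary has second fundamental form `> -Δ`") in the chart form used by
the tree. Everything is proved; no definitions, no named facts.

## References

* A. Weinstein, *The cut locus and conjugate locus of a Riemannian manifold*, Ann. of Math. (2)
  87 (1968), 29–41, proof of the main theorem, steps (1)–(2). [cite: Weinstein1968]
* J. M. Lee, *Introduction to Riemannian Manifolds*, 2nd ed. (2018), Prop. 5.26 (Fermi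
  coordinates). [cite: LeeRiemannianManifolds2018, Prop. 5.26]

Tags: [FermiCoordinates] [Surgery] [Weinstein1968]
-/

noncomputable section

open Bundle Set Filter Function InnerProductSpace TopologicalSpace Metric Module
open scoped Manifold ContDiff Topology RealInnerProductSpace

namespace Literature.Geometry.Riemannian

open Literature.Geometry.Lorentzian
open Literature.Geometry.Lorentzian.OpensChart
open Literature.Geometry.Lorentzian.PseudoRiemannianMetric
open Literature.Geometry.Manifold

/-! ### The linear rounding of the axis -/

section AxisScaling

variable {V : Type*} [NormedAddCommGroup V] [InnerProductSpace ℝ V] {ε₀ : V}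

/-- **The axis scaling** `A v = a ⟪ε₀, v⟫ ε₀ + b v^⊥` for a unit vector `ε₀` and `a, b ≠ 0` is a
continuous linear automorphism with inverse `a⁻¹ ⟪ε₀, ·⟫ ε₀ + b⁻¹ (·)^⊥`. [folklore] -/
theorem exists_axisScaling (hε₀ : ‖ε₀‖ = 1) {a b : ℝ} (ha : a ≠ 0) (hb : b ≠ 0) :
    ∃ A : V ≃L[ℝ] V, (∀ v, A v = a • ⟪ε₀, v⟫ • ε₀ + b • (v - ⟪ε₀, v⟫ • ε₀)) ∧
      ∀ v, A.symm v = a⁻¹ • ⟪ε₀, v⟫ • ε₀ + b⁻¹ • (v - ⟪ε₀, v⟫ • ε₀) := by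
  set P : V →L[ℝ] V := (innerSL ℝ ε₀).smulRight ε₀ with hPdef
  have hPa : ∀ v, P v = ⟪ε₀, v⟫ • ε₀ := fun v ↦ by
    simp [hPdef, ContinuousLinearMap.smulRight_apply]
  set f : V →L[ℝ] V := a • P + b • (ContinuousLinearMap.id ℝ V - P) with hf
  set f' : V →L[ℝ] V := a⁻¹ • P + b⁻¹ • (ContinuousLinearMap.id ℝ V - P) with hf'
  have hfa : ∀ v, f v = a • ⟪ε₀, v⟫ • ε₀ + b • (v - ⟪ε₀, v⟫ • ε₀) := fun v ↦ by
    simp [hf, hPa]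
  have hf'a : ∀ v, f' v = a⁻¹ • ⟪ε₀, v⟫ • ε₀ + b⁻¹ • (v - ⟪ε₀, v⟫ • ε₀) := fun v ↦ by
    simp [hf', hPa]
  have key : ∀ (s t s' t' : ℝ) (v : V),
      s' • ⟪ε₀, s • ⟪ε₀, v⟫ • ε₀ + t • (v - ⟪ε₀, v⟫ • ε₀)⟫ • ε₀ +
        t' • ((s • ⟪ε₀, v⟫ • ε₀ + t • (v - ⟪ε₀, v⟫ • ε₀)) -
          ⟪ε₀, s • ⟪ε₀, v⟫ • ε₀ + t • (v - ⟪ε₀, v⟫ • ε₀)⟫ • ε₀) =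
      (s' * s) • ⟪ε₀, v⟫ • ε₀ + (t' * t) • (v - ⟪ε₀, v⟫ • ε₀) := by
    intro s t s' t' v
    have h1 : ⟪ε₀, s • ⟪ε₀, v⟫ • ε₀ + t • (v - ⟪ε₀, v⟫ • ε₀)⟫ = s * ⟪ε₀, v⟫ := by
      simp only [inner_add_right, inner_smul_right, inner_sub_right, real_inner_self_eq_norm_sq,
        hε₀]
      ring
    rw [h1]
    module
  have h₁ : Function.LeftInverse f' f := fun v ↦ by
    rw [hfa, hf'a, key, inv_mul_cancel₀ ha, inv_mul_cancel₀ hb, one_smul, one_smul]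
    abel
  have h₂ : Function.RightInverse f' f := fun v ↦ by
    rw [hfa, hf'a, key, mul_inv_cancel₀ ha, mul_inv_cancel₀ hb, one_smul, one_smul]
    abel
  exact ⟨ContinuousLinearEquiv.equivOfInverse f f' h₁ h₂, hfa, hf'a⟩

/-- Coordinates of the axis scaling: `⟪ε₀, A v⟫ = a ⟪ε₀, v⟫` and `(A v)^⊥ = b v^⊥`. [folklore] -/
theorem axisScaling_coords (hε₀ : ‖ε₀‖ = 1) (a b : ℝ) (v : V) :
    ⟪ε₀, a • ⟪ε₀, v⟫ • ε₀ + b • (v - ⟪ε₀, v⟫ • ε₀)⟫ = a * ⟪ε₀, v⟫ ∧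
      (a • ⟪ε₀, v⟫ • ε₀ + b • (v - ⟪ε₀, v⟫ • ε₀)) -
          ⟪ε₀, a • ⟪ε₀, v⟫ • ε₀ + b • (v - ⟪ε₀, v⟫ • ε₀)⟫ • ε₀ =
        b • (v - ⟪ε₀, v⟫ • ε₀) := by
  have h1 : ⟪ε₀, a • ⟪ε₀, v⟫ • ε₀ + b • (v - ⟪ε₀, v⟫ • ε₀)⟫ = a * ⟪ε₀, v⟫ := by
    simp only [inner_add_right, inner_smul_right, inner_sub_right, real_inner_self_eq_norm_sq,
      hε₀]
    ring
  refine ⟨h1, ?_⟩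
  rw [h1]
  module

/-- Pythagoras along the axis: `‖v‖² = ⟪ε₀, v⟫² + ‖v^⊥‖²`. [folklore] -/
theorem norm_sq_eq_inner_sq_add (hε₀ : ‖ε₀‖ = 1) (v : V) :
    ‖v‖ ^ 2 = ⟪ε₀, v⟫ ^ 2 + ‖v - ⟪ε₀, v⟫ • ε₀‖ ^ 2 := by
  have hP : ⟪ε₀, ⟪ε₀, v⟫ • ε₀⟫ = ⟪ε₀, v⟫ := by
    rw [inner_smul_right, real_inner_self_eq_norm_sq, hε₀, one_pow, mul_one]
  have horth : ⟪⟪ε₀, v⟫ • ε₀, v - ⟪ε₀, v⟫ • ε₀⟫ = 0 := by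
    rw [inner_smul_left, inner_sub_right, hP, sub_self, mul_zero]
  have hdec : v = ⟪ε₀, v⟫ • ε₀ + (v - ⟪ε₀, v⟫ • ε₀) := by abel
  have h := norm_add_sq_eq_norm_sq_add_norm_sq_of_inner_eq_zero _ _ horth
  rw [← hdec] at h
  rw [sq, sq, sq, h, norm_smul, Real.norm_eq_abs, hε₀, mul_one, abs_mul_abs_self]

end AxisScaling

/-! ### The round model -/

section RoundModel

variable {V : Type*} [NormedAddCommGroup V] [InnerProductSpace ℝ V] [FiniteDimensional ℝ V]
  {E : Type*} [NormedAddCommGroup E] [NormedSpace ℝ E] {H : Type*} [TopologicalSpace H]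
  {I : ModelWithCorners ℝ E H} {M : Type*} [TopologicalSpace M] [ChartedSpace H M]
  [IsManifold I ∞ M] [FiniteDimensional ℝ E] [CompleteSpace E] [T2Space M] [I.Boundaryless]
  (g : PseudoRiemannianMetric I ∞ E (TangentSpace I : M → Type _)) [g.HasLeviCivita]
  [CovariantDerivative.ContMDiffCovariantDerivative g.leviCivita 1]
  [CovariantDerivative.ContMDiffCovariantDerivative g.leviCivita ((⊤ : ℕ∞) : ℕ∞ω)]
  {c : ℝ → M} {e : Π t : ℝ, V →L[ℝ] TangentSpace I (c t)} {ε₀ : V}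

set_option maxHeartbeats 3200000 in
/-- **The round model of a thin tube around an embedded arc.** See the module docstring.
[cite: Weinstein1968, proof of the main theorem, steps (1)–(2)]
[cite: LeeRiemannianManifolds2018, Prop. 5.26] -/
theorem exists_tube_round_model (hg : g.IsRiemannian)
    (hgc : IsGeodesicallyComplete g.leviCivita)
    (hs : ContMDiff (𝓘(ℝ, ℝ).prod 𝓘(ℝ, V)) I.tangent ∞
      (fun q : ℝ × V ↦ (TotalSpace.mk' E (c q.1) (e q.1 q.2) : TangentBundle I M)))
    (hε₀ : ‖ε₀‖ = 1) (he₀ : ∀ t, e t ε₀ = (velocity I c t : E))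
    (hiso : ∀ t (u w : V), g.val (c t) (e t u) (e t w) = ⟪u, w⟫)
    (hpar : ∀ t (u : V), ⟪ε₀, u⟫ = 0 → covariantDerivAlong g.leviCivita c (fun t ↦ e t u) t =
      -(g.val (c t) (e t u) (covariantDerivAlong g.leviCivita c (fun t ↦ velocity I c t) t)) •
        (velocity I c t))
    {K : ℝ} (hK : 0 ≤ K)
    (hcurv : ∀ x₁ ∈ Icc (-1 : ℝ) 1, g.val (c x₁)
      (covariantDerivAlong g.leviCivita c (fun t ↦ velocity I c t) x₁)
      (covariantDerivAlong g.leviCivita c (fun t ↦ velocity I c t) x₁) ≤ K ^ 2)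
    (hgeod : ∀ x₁ ∈ Icc (-1 : ℝ) 1, g.val (c x₁)
      (covariantDerivAlong g.leviCivita c (fun t ↦ velocity I c t) x₁) (velocity I c x₁) = 0)
    (hcinj : InjOn c (Icc (-1 : ℝ) 1)) (hdim : finrank ℝ V = finrank ℝ E) :
    ∃ (U : Opens V) (gU : PseudoRiemannianMetric 𝓘(ℝ, V) ∞ V (TangentSpace 𝓘(ℝ, V) : U → Type _))
      (GU : V → V →L[ℝ] V →L[ℝ] ℝ) (_u₀ : U) (A : V ≃L[ℝ] V) (lam : ℝ),
      (∀ y : U, gU.val y = GU y) ∧ gU.IsRiemannian ∧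
      ball (0 : V) (1 + 1 / 4) ⊆ (U : Set V) ∧
      ContMDiff 𝓘(ℝ, V) I ∞ (fun y : V ↦ expMap g.leviCivita (c ⟪ε₀, A.symm y⟫)
        (e ⟪ε₀, A.symm y⟫ (A.symm y - ⟪ε₀, A.symm y⟫ • ε₀))) ∧
      InjOn (fun y : V ↦ expMap g.leviCivita (c ⟪ε₀, A.symm y⟫)
        (e ⟪ε₀, A.symm y⟫ (A.symm y - ⟪ε₀, A.symm y⟫ • ε₀))) U ∧
      (∀ y ∈ (U : Set V), Injective (mfderiv 𝓘(ℝ, V) I (fun y : V ↦ expMap g.leviCivita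
        (c ⟪ε₀, A.symm y⟫) (e ⟪ε₀, A.symm y⟫ (A.symm y - ⟪ε₀, A.symm y⟫ • ε₀))) y)) ∧
      (∀ y ∈ (U : Set V), ∀ u w : V, GU y u w =
        g.val (expMap g.leviCivita (c ⟪ε₀, A.symm y⟫)
            (e ⟪ε₀, A.symm y⟫ (A.symm y - ⟪ε₀, A.symm y⟫ • ε₀)))
          (mfderiv 𝓘(ℝ, V) I (fun y : V ↦ expMap g.leviCivita (c ⟪ε₀, A.symm y⟫)
            (e ⟪ε₀, A.symm y⟫ (A.symm y - ⟪ε₀, A.symm y⟫ • ε₀))) y u)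
          (mfderiv 𝓘(ℝ, V) I (fun y : V ↦ expMap g.leviCivita (c ⟪ε₀, A.symm y⟫)
            (e ⟪ε₀, A.symm y⟫ (A.symm y - ⟪ε₀, A.symm y⟫ • ε₀))) y w)) ∧
      (∀ p : U, ‖(p : V)‖ = 1 →
        1 ≤ GU p ((GU p).inverse (innerSL ℝ (p : V))) ((GU p).inverse (innerSL ℝ (p : V)))) ∧
      0 ≤ lam ∧ lam ≤ 5 * K + 3 ∧
      (∀ p : U, ‖(p : V)‖ = 1 → ∀ X : V,
        ⟪(p : V), christoffel gU GU p X X⟫ ≤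
          lam * Real.sqrt (GU p ((GU p).inverse (innerSL ℝ (p : V)))
            ((GU p).inverse (innerSL ℝ (p : V)))) * GU p X X) ∧
      (∀ x₁ ∈ Icc (-(1 / 2) : ℝ) (1 / 2), ∃ y ∈ closedBall (0 : V) 1,
        expMap g.leviCivita (c ⟪ε₀, A.symm y⟫)
          (e ⟪ε₀, A.symm y⟫ (A.symm y - ⟪ε₀, A.symm y⟫ • ε₀)) = c x₁) := by
  classical
  haveI : CompleteSpace V := FiniteDimensional.complete ℝ V
  haveI hfact : Fact ((1 : ℕ∞ω) ≤ ∞) := ⟨by exact_mod_cast le_top⟩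
  have hP : ∀ v : V, ⟪ε₀, ⟪ε₀, v⟫ • ε₀⟫ = ⟪ε₀, v⟫ := fun v ↦ by
    rw [inner_smul_right, real_inner_self_eq_norm_sq, hε₀, one_pow, mul_one]
  /- ── the tube map ── -/
  set Φ : V → M := fun v ↦ expMap g.leviCivita (c ⟪ε₀, v⟫) (e ⟪ε₀, v⟫ (v - ⟪ε₀, v⟫ • ε₀))
    with hΦdef
  have hΦs : ContMDiff 𝓘(ℝ, V) I ∞ Φ := contMDiff_tubeMap (cov := g.leviCivita) hgc hs
  have hax : ∀ x₁ : ℝ, Φ (x₁ • ε₀) = c x₁ := fun x₁ ↦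
    tubeMap_axis (cov := g.leviCivita) (e := e) hε₀ x₁
  have heinj : ∀ t, Injective (e t) := by
    intro t u w huw
    have h0 : e t (u - w) = 0 := by rw [map_sub, huw, sub_self]
    have h1 : ⟪u - w, u - w⟫ = 0 := by rw [← hiso t, h0]; simp
    exact sub_eq_zero.1 (inner_self_eq_zero.1 h1)
  /- ── (1) injectivity and local diffeomorphy on a solid tube over `[-1, 1]` ── -/
  obtain ⟨r, hr, hinj, hloc⟩ := exists_tube_injOn_tubeMap (cov := g.leviCivita) hgc hs hε₀ he₀
    heinj hdim hcinj
  /- ── (2) the open solid tube `U₀` and its chart metric ── -/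
  have hcont1 : Continuous fun v : V ↦ ⟪ε₀, v⟫ := continuous_const.inner continuous_id
  have hcont2 : Continuous fun v : V ↦ ‖v - ⟪ε₀, v⟫ • ε₀‖ :=
    (continuous_id.sub (hcont1.smul continuous_const)).norm
  let U₀ : Opens V := ⟨{v : V | ⟪ε₀, v⟫ ∈ Ioo (-1 : ℝ) 1 ∧ ‖v - ⟪ε₀, v⟫ • ε₀‖ < r},
    (isOpen_Ioo.preimage hcont1).inter (isOpen_lt hcont2 continuous_const)⟩
  have hU₀mem : ∀ {v : V}, v ∈ (U₀ : Set V) ↔ ⟪ε₀, v⟫ ∈ Ioo (-1 : ℝ) 1 ∧ ‖v - ⟪ε₀, v⟫ • ε₀‖ < r :=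
    Iff.rfl
  have hU₀sub : ∀ v ∈ (U₀ : Set V), ⟪ε₀, v⟫ ∈ Icc (-1 : ℝ) 1 ∧ ‖v - ⟪ε₀, v⟫ • ε₀‖ < r :=
    fun v hv ↦ ⟨Ioo_subset_Icc_self (hU₀mem.1 hv).1, (hU₀mem.1 hv).2⟩
  have hn0 : (∞ : ℕ∞ω) ≠ 0 := by simp
  have hdΦ : ∀ v ∈ (U₀ : Set V), Injective (mfderiv 𝓘(ℝ, V) I Φ v) := by
    intro v hv
    have hl : IsLocalDiffeomorphAt 𝓘(ℝ, V) I ∞ Φ v := hloc v (hU₀sub v hv).1 (hU₀sub v hv).2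
    exact (hl.mfderivToContinuousLinearEquiv hn0).injective
  -- the chart metric `g_{U₀} = (Φ ∘ ι)^* g` on `U₀`
  have hpb₀ : contMDiff_pullbackBilin I M 𝓘(ℝ, V) U₀ ∞ := contMDiff_pullbackBilin_holds
  set f₀ : U₀ → M := fun y ↦ Φ y with hf₀def
  have hf₀s : ContMDiff 𝓘(ℝ, V) I ((∞ : ℕ∞ω) + 1) f₀ :=
    (hΦs.comp contMDiff_subtype_val).of_le (le_of_eq (by rfl))
  have hdf₀ : ∀ (y : U₀) (u : V), mfderiv 𝓘(ℝ, V) I f₀ y u = mfderiv 𝓘(ℝ, V) I Φ y u := by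
    intro y u
    have hc : f₀ = Φ ∘ (Subtype.val : U₀ → V) := rfl
    rw [hc, mfderiv_comp y (hΦs.mdifferentiableAt hn0)
      ((contMDiff_subtype_val (n := ∞) y).mdifferentiableAt hn0)]
    show mfderiv 𝓘(ℝ, V) I Φ y (mfderiv 𝓘(ℝ, V) 𝓘(ℝ, V) (Subtype.val : U₀ → V) y u) = _
    rw [OpenSubmanifold.mfderiv_subtype_val]
    rfl
  have hf₀' : ∀ y : U₀, Injective (mfderiv 𝓘(ℝ, V) I f₀ y) := by
    intro y u w huw
    rw [hdf₀, hdf₀] at huw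
    exact hdΦ y y.2 huw
  set gU₀ := g.comap hpb₀ f₀ hf₀s hf₀' hdim with hgU₀def
  set GU₀ : V → V →L[ℝ] V →L[ℝ] ℝ := fun v ↦
    if hv : v ∈ (U₀ : Set V) then gU₀.val ⟨v, hv⟩ else 0 with hGU₀def
  have hG₀ : ∀ y : U₀, gU₀.val y = GU₀ y := fun y ↦ by
    rw [hGU₀def]; simp
  have hval₀ : ∀ (y : U₀) (u w : V), GU₀ y u w =
      g.val (Φ y) (mfderiv 𝓘(ℝ, V) I Φ y u) (mfderiv 𝓘(ℝ, V) I Φ y w) := by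
    intro y u w
    rw [← hG₀ y, hgU₀def, val_comap]
    show g.val (f₀ y) (mfderiv 𝓘(ℝ, V) I f₀ y u) (mfderiv 𝓘(ℝ, V) I f₀ y w) = _
    rw [hdf₀, hdf₀]
  have hgU₀ : gU₀.IsRiemannian := by
    intro y u hu
    rw [hgU₀def, val_comap]
    show 0 < g.val (f₀ y) (mfderiv 𝓘(ℝ, V) I f₀ y u) (mfderiv 𝓘(ℝ, V) I f₀ y u)
    exact hg _ _ fun h ↦ hu (hf₀' y (by rw [h, map_zero]))
  haveI : gU₀.HasLeviCivita := gU₀.hasLeviCivita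
  have hG₀d : ∀ y : U₀, DifferentiableAt ℝ GU₀ y := fun y ↦
    (contDiffAt_metricComponents gU₀ GU₀ hG₀ y).differentiableAt (by simp)
  /- ── (3) the near-axis estimates over `[-3/4, 3/4]` ── -/
  have haxW : ∀ x₁ ∈ Icc (-(3 / 4) : ℝ) (3 / 4), x₁ • ε₀ ∈ (U₀ : Set V) := by
    intro x₁ hx₁
    rw [hU₀mem, inner_smul_unit_self hε₀, sub_self, norm_zero]
    exact ⟨⟨by linarith [hx₁.1], by linarith [hx₁.2]⟩, hr⟩
  have hGUW : ∀ v ∈ (U₀ : Set V), ∀ u w : V, GU₀ v u w =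
      g.val (Φ v) (mfderiv 𝓘(ℝ, V) I Φ v u) (mfderiv 𝓘(ℝ, V) I Φ v w) :=
    fun v hv u w ↦ hval₀ ⟨v, hv⟩ u w
  have hcurv' : ∀ x₁ ∈ Icc (-(3 / 4) : ℝ) (3 / 4), g.val (c x₁)
      (covariantDerivAlong g.leviCivita c (fun t ↦ velocity I c t) x₁)
      (covariantDerivAlong g.leviCivita c (fun t ↦ velocity I c t) x₁) ≤ K ^ 2 :=
    fun x₁ hx₁ ↦ hcurv x₁ ⟨by linarith [hx₁.1], by linarith [hx₁.2]⟩
  have hgeod' : ∀ x₁ ∈ Icc (-(3 / 4) : ℝ) (3 / 4), g.val (c x₁)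
      (covariantDerivAlong g.leviCivita c (fun t ↦ velocity I c t) x₁) (velocity I c x₁) = 0 :=
    fun x₁ hx₁ ↦ hgeod x₁ ⟨by linarith [hx₁.1], by linarith [hx₁.2]⟩
  obtain ⟨δ₁, hδ₁, hΓ₁⟩ := exists_abs_inner_christoffel_tube_le g gU₀ GU₀ (le_refl _) hg hgc hs
    hε₀ he₀ hiso hpar hK hcurv' hgeod' hG₀ hG₀d U₀.isOpen subset_rfl haxW hGUW one_pos
  obtain ⟨δ₂, hδ₂, hcmp⟩ := exists_tube_metric_near_inner g gU₀ GU₀ hgc hs hε₀ he₀ hiso hG₀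
    U₀.isOpen subset_rfl haxW hGUW (η := 1 / 2) (by norm_num)
  /- ── (4) the tube radius `ρ` and the linear rounding `A` ── -/
  set ρ : ℝ := min (min r (1 / 2)) (min δ₁ δ₂) / 2 with hρdef
  have hρ : 0 < ρ := by rw [hρdef]; positivity
  have hρr : ρ ≤ r / 2 := by
    rw [hρdef]
    linarith [min_le_left (min r (1 / 2)) (min δ₁ δ₂), min_le_left r (1 / 2)]
  have hρhalf : ρ ≤ 1 / 4 := by
    rw [hρdef]
    linarith [min_le_left (min r (1 / 2)) (min δ₁ δ₂), min_le_right r (1 / 2)]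
  have hρ₁ : ρ < δ₁ := by
    rw [hρdef]
    linarith [min_le_right (min r (1 / 2)) (min δ₁ δ₂), min_le_left δ₁ δ₂]
  have hρ₂ : ρ < δ₂ := by
    rw [hρdef]
    linarith [min_le_right (min r (1 / 2)) (min δ₁ δ₂), min_le_right δ₁ δ₂]
  obtain ⟨A, hA, hAs⟩ := exists_axisScaling (V := V) hε₀ (a := 2) (b := ρ⁻¹) two_ne_zero
    (inv_ne_zero hρ.ne')
  have hAs' : ∀ v, A.symm v = (1 / 2 : ℝ) • ⟪ε₀, v⟫ • ε₀ + ρ • (v - ⟪ε₀, v⟫ • ε₀) := by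
    intro v; rw [hAs v, inv_inv]; norm_num
  -- coordinates of `A.symm y`
  have hsymm_coords : ∀ y : V, ⟪ε₀, A.symm y⟫ = (1 / 2) * ⟪ε₀, y⟫ ∧
      A.symm y - ⟪ε₀, A.symm y⟫ • ε₀ = ρ • (y - ⟪ε₀, y⟫ • ε₀) := by
    intro y
    have h := axisScaling_coords hε₀ (1 / 2) ρ y
    rw [← hAs' y] at h
    exact h
  have hsymm_norm : ∀ y : V, ‖A.symm y - ⟪ε₀, A.symm y⟫ • ε₀‖ = ρ * ‖y - ⟪ε₀, y⟫ • ε₀‖ := by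
    intro y
    rw [(hsymm_coords y).2, norm_smul, Real.norm_eq_abs, abs_of_pos hρ]
  -- `A.symm` maps the ball of radius `5/4` into the solid tube of radius `ρ · 5/4 < r` over `(-1, 1)`
  have hcomp_le : ∀ y : V, |⟪ε₀, y⟫| ≤ ‖y‖ ∧ ‖y - ⟪ε₀, y⟫ • ε₀‖ ≤ ‖y‖ := by
    intro y
    have h := norm_sq_eq_inner_sq_add hε₀ y
    constructor
    · have h1 : ⟪ε₀, y⟫ ^ 2 ≤ ‖y‖ ^ 2 := by nlinarith [sq_nonneg ‖y - ⟪ε₀, y⟫ • ε₀‖]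
      exact abs_le_of_sq_le_sq h1 (norm_nonneg _)
    · have h1 : ‖y - ⟪ε₀, y⟫ • ε₀‖ ^ 2 ≤ ‖y‖ ^ 2 := by nlinarith [sq_nonneg ⟪ε₀, y⟫]
      exact le_of_sq_le_sq h1 (norm_nonneg _)
  have hmemU₀ : ∀ y : V, ‖y‖ < 1 + 1 / 4 → A.symm y ∈ (U₀ : Set V) := by
    intro y hy
    rw [hU₀mem, hsymm_norm, (hsymm_coords y).1]
    obtain ⟨h1, h2⟩ := hcomp_le y
    refine ⟨⟨?_, ?_⟩, ?_⟩
    · have := (abs_le.1 h1).1; linarith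
    · have := (abs_le.1 h1).2; linarith
    · calc ρ * ‖y - ⟪ε₀, y⟫ • ε₀‖ ≤ ρ * ‖y‖ := mul_le_mul_of_nonneg_left h2 hρ.le
        _ < ρ * (1 + 1 / 4) := mul_lt_mul_of_pos_left hy hρ
        _ ≤ r / 2 * (1 + 1 / 4) := mul_le_mul_of_nonneg_right hρr (by norm_num)
        _ < r := by linarith
  /- ── (5) the round open set `U = A(U₀)` and its chart metric ── -/
  let U : Opens V := ⟨A.symm ⁻¹' (U₀ : Set V), U₀.isOpen.preimage A.symm.continuous⟩
  have hUmem : ∀ {y : V}, y ∈ (U : Set V) ↔ A.symm y ∈ (U₀ : Set V) := Iff.rfl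
  have hUball : ball (0 : V) (1 + 1 / 4) ⊆ (U : Set V) := fun y hy ↦ by
    rw [hUmem]; exact hmemU₀ y (by rwa [mem_ball, dist_zero_right] at hy)
  set ΦA : V → M := fun y ↦ Φ (A.symm y) with hΦAdef
  have hΦAs : ContMDiff 𝓘(ℝ, V) I ∞ ΦA := hΦs.comp A.symm.contDiff.contMDiff
  have hdΦA : ∀ (y : V) (u : V), mfderiv 𝓘(ℝ, V) I ΦA y u = mfderiv 𝓘(ℝ, V) I Φ (A.symm y) (A.symm u) := by
    intro y u
    have hc : ΦA = Φ ∘ (A.symm : V → V) := rfl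
    rw [hc, mfderiv_comp y (hΦs.mdifferentiableAt hn0) A.symm.mdifferentiableAt]
    show mfderiv 𝓘(ℝ, V) I Φ (A.symm y) (mfderiv 𝓘(ℝ, V) 𝓘(ℝ, V) (A.symm : V → V) y u) = _
    rw [A.symm.mfderiv_eq]
    rfl
  have hdΦAinj : ∀ y ∈ (U : Set V), Injective (mfderiv 𝓘(ℝ, V) I ΦA y) := by
    intro y hy u w huw
    rw [hdΦA, hdΦA] at huw
    exact A.symm.injective (hdΦ _ (hUmem.1 hy) huw)
  have hΦAinj : InjOn ΦA U := by
    intro y hy y' hy' h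
    exact A.symm.injective (hinj (hU₀sub _ (hUmem.1 hy)) (hU₀sub _ (hUmem.1 hy')) h)
  -- the chart metric `g_U = (Φ_A ∘ ι)^* g` on `U`
  have hpb₁ : contMDiff_pullbackBilin I M 𝓘(ℝ, V) U ∞ := contMDiff_pullbackBilin_holds
  set f₁ : U → M := fun y ↦ ΦA y with hf₁def
  have hf₁s : ContMDiff 𝓘(ℝ, V) I ((∞ : ℕ∞ω) + 1) f₁ :=
    (hΦAs.comp contMDiff_subtype_val).of_le (le_of_eq (by rfl))
  have hdf₁ : ∀ (y : U) (u : V), mfderiv 𝓘(ℝ, V) I f₁ y u = mfderiv 𝓘(ℝ, V) I ΦA y u := by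
    intro y u
    have hc : f₁ = ΦA ∘ (Subtype.val : U → V) := rfl
    rw [hc, mfderiv_comp y (hΦAs.mdifferentiableAt hn0)
      ((contMDiff_subtype_val (n := ∞) y).mdifferentiableAt hn0)]
    show mfderiv 𝓘(ℝ, V) I ΦA y (mfderiv 𝓘(ℝ, V) 𝓘(ℝ, V) (Subtype.val : U → V) y u) = _
    rw [OpenSubmanifold.mfderiv_subtype_val]
    rfl
  have hf₁' : ∀ y : U, Injective (mfderiv 𝓘(ℝ, V) I f₁ y) := by
    intro y u w huw
    rw [hdf₁, hdf₁] at huw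
    exact hdΦAinj y y.2 huw
  set gU := g.comap hpb₁ f₁ hf₁s hf₁' hdim with hgUdef
  set GU : V → V →L[ℝ] V →L[ℝ] ℝ := fun v ↦
    if hv : v ∈ (U : Set V) then gU.val ⟨v, hv⟩ else 0 with hGUdef
  have hG : ∀ y : U, gU.val y = GU y := fun y ↦ by
    rw [hGUdef]; simp
  have hval : ∀ (y : U) (u w : V), GU y u w =
      g.val (ΦA y) (mfderiv 𝓘(ℝ, V) I ΦA y u) (mfderiv 𝓘(ℝ, V) I ΦA y w) := by
    intro y u w
    rw [← hG y, hgUdef, val_comap]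
    show g.val (f₁ y) (mfderiv 𝓘(ℝ, V) I f₁ y u) (mfderiv 𝓘(ℝ, V) I f₁ y w) = _
    rw [hdf₁, hdf₁]
  have hgU : gU.IsRiemannian := by
    intro y u hu
    rw [hgUdef, val_comap]
    show 0 < g.val (f₁ y) (mfderiv 𝓘(ℝ, V) I f₁ y u) (mfderiv 𝓘(ℝ, V) I f₁ y u)
    exact hg _ _ fun h ↦ hu (hf₁' y (by rw [h, map_zero]))
  -- the two chart metrics are related by `A`
  have hpull : ∀ v ∈ (U₀ : Set V), ∀ u w : V, GU₀ v u w = GU (A v) (A u) (A w) := by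
    intro v hv u w
    have hAv : A v ∈ (U : Set V) := by rw [hUmem, A.symm_apply_apply]; exact hv
    rw [hGUW v hv, hval ⟨A v, hAv⟩, hdΦA, hdΦA]
    have key : ∀ y y' : V, y = y' → ∀ a b : V,
        g.val (Φ y) (mfderiv 𝓘(ℝ, V) I Φ y a) (mfderiv 𝓘(ℝ, V) I Φ y b) =
          g.val (Φ y') (mfderiv 𝓘(ℝ, V) I Φ y' a) (mfderiv 𝓘(ℝ, V) I Φ y' b) := by
      rintro y y' rfl a b; rfl
    have h := key v (A.symm (A v)) (A.symm_apply_apply v).symm u w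
    simp only [A.symm_apply_apply] at h ⊢
    exact h
  /- ── (6) the data on the unit sphere of `U` ── -/
  have hsphere : ∀ p : V, ‖p‖ = 1 → A.symm p ∈ (U₀ : Set V) ∧
      ⟪ε₀, A.symm p⟫ ∈ Icc (-(3 / 4) : ℝ) (3 / 4) ∧
      ‖A.symm p - ⟪ε₀, A.symm p⟫ • ε₀‖ ≤ ρ := by
    intro p hp
    refine ⟨hmemU₀ p (by rw [hp]; norm_num), ?_, ?_⟩
    · rw [(hsymm_coords p).1]
      have h1 := (hcomp_le p).1
      rw [hp] at h1
      constructor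
      · have := (abs_le.1 h1).1; linarith
      · have := (abs_le.1 h1).2; linarith
    · rw [hsymm_norm]
      have h2 := (hcomp_le p).2
      rw [hp] at h2
      calc ρ * ‖p - ⟪ε₀, p⟫ • ε₀‖ ≤ ρ * 1 := mul_le_mul_of_nonneg_left h2 hρ.le
        _ = ρ := mul_one ρ
  have hdata : ∀ p : U, ‖(p : V)‖ = 1 → ∃ x : U₀, A (x : V) = (p : V) ∧
      (∀ w X' : V, |⟪w, christoffel gU₀ GU₀ x X' X'⟫| ≤ (2 * K + 1) * ‖X'‖ ^ 2 * ‖w‖) ∧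
      (∀ Y : V, (1 - 1 / 2) * ‖Y‖ ^ 2 ≤ GU₀ x Y Y ∧ GU₀ x Y Y ≤ (1 + 1 / 2) * ‖Y‖ ^ 2) ∧
      (∀ᶠ v in 𝓝 (x : V), ∀ u w : V, GU₀ v u w = GU (A v) (A u) (A w)) := by
    intro p hp
    obtain ⟨hpU₀, hx1, hx2⟩ := hsphere p hp
    refine ⟨⟨A.symm p, hpU₀⟩, A.apply_symm_apply (p : V), ?_, ?_, ?_⟩
    · intro w X'
      have h := hΓ₁ ⟨A.symm p, hpU₀⟩ hx1 (lt_of_le_of_lt hx2 hρ₁) (w - ⟪ε₀, w⟫ • ε₀)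
        (by rw [inner_sub_right, hP, sub_self]) ⟪ε₀, w⟫ 1 X'
      have hw : ⟪ε₀, w⟫ • ε₀ + (1 : ℝ) • (w - ⟪ε₀, w⟫ • ε₀) = w := by rw [one_smul]; abel
      rwa [hw] at h
    · intro Y
      exact hcmp ⟨A.symm p, hpU₀⟩ hx1 (lt_of_le_of_lt hx2 hρ₂) Y
    · filter_upwards [U₀.isOpen.mem_nhds hpU₀] with v hv using hpull v hv
  set lam : ℝ := (2 * K + 1) * Real.sqrt (1 + 1 / 2) / (1 - 1 / 2) with hlamdef
  have hlam0 : 0 ≤ lam := by rw [hlamdef]; positivity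
  have hlamle : lam ≤ 5 * K + 3 := by
    have hsq : Real.sqrt (1 + 1 / 2) ≤ 5 / 4 :=
      (Real.sqrt_le_sqrt (by norm_num : (1 : ℝ) + 1 / 2 ≤ (5 / 4) ^ 2)).trans
        (le_of_eq (Real.sqrt_sq (by norm_num)))
    rw [hlamdef]
    have h1 : (2 * K + 1) * Real.sqrt (1 + 1 / 2) ≤ (2 * K + 1) * (5 / 4) :=
      mul_le_mul_of_nonneg_left hsq (by positivity)
    rw [div_le_iff₀ (by norm_num : (0 : ℝ) < 1 - 1 / 2)]
    nlinarith
  have hΓ : ∀ p : U, ‖(p : V)‖ = 1 → ∀ X : V,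
      ⟪(p : V), christoffel gU GU p X X⟫ ≤
        lam * Real.sqrt (GU p ((GU p).inverse (innerSL ℝ (p : V)))
          ((GU p).inverse (innerSL ℝ (p : V)))) * GU p X X := by
    intro p hp X
    have h := sphere_inner_christoffel_le gU₀ gU GU₀ GU A hG₀ hG hgU (C := 2 * K + 1)
      (η := 1 / 2) (by positivity) (by norm_num) (by norm_num) hdata p hp X
    rw [hlamdef]
    exact h
  /- ── (7) the normalisation `q ≥ 1` ── -/
  have hq1 : ∀ p : U, ‖(p : V)‖ = 1 →
      1 ≤ GU p ((GU p).inverse (innerSL ℝ (p : V))) ((GU p).inverse (innerSL ℝ (p : V))) := by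
    intro p hp
    obtain ⟨hpU₀, hx1, hx2⟩ := hsphere p hp
    have h1 := inner_sq_le_rawNormal_mul gU GU hG hgU p (A (p : V))
    -- `G_U(p)(A p, A p) = G_{U₀}(A⁻¹ p)(p, p) ≤ 3/2`
    have h2 : GU (p : V) (A (p : V)) (A (p : V)) ≤ 3 / 2 := by
      have e1 := hpull (A.symm p) hpU₀ (p : V) (p : V)
      rw [A.apply_symm_apply] at e1
      rw [← e1]
      have h3 := (hcmp ⟨A.symm p, hpU₀⟩ hx1 (lt_of_le_of_lt hx2 hρ₂) (p : V)).2
      rw [hp] at h3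
      norm_num at h3 ⊢
      exact h3
    -- `⟪p, A p⟫ ≥ 2`
    have h4 : 2 ≤ ⟪(p : V), A (p : V)⟫ := by
      have hpy := norm_sq_eq_inner_sq_add hε₀ (p : V)
      rw [hp, one_pow] at hpy
      have hi : ⟪(p : V), (p : V) - ⟪ε₀, (p : V)⟫ • ε₀⟫ = 1 - ⟪ε₀, (p : V)⟫ ^ 2 := by
        rw [inner_sub_right, real_inner_self_eq_norm_sq, hp, inner_smul_right, real_inner_comm]
        ring
      have hperp : ‖(p : V) - ⟪ε₀, (p : V)⟫ • ε₀‖ ^ 2 = 1 - ⟪ε₀, (p : V)⟫ ^ 2 := by linarith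
      rw [hA, inner_add_right, inner_smul_right, inner_smul_right, inner_smul_right, hi,
        real_inner_comm ε₀]
      have hρinv : (4 : ℝ) ≤ ρ⁻¹ := by
        rw [le_inv_comm₀ (by norm_num) hρ]; linarith
      have h5 : 0 ≤ 1 - ⟪ε₀, (p : V)⟫ ^ 2 := by rw [← hperp]; positivity
      nlinarith
    have h6 : (4 : ℝ) ≤ ⟪(p : V), A (p : V)⟫ ^ 2 := by nlinarith
    -- combine
    set q := GU p ((GU p).inverse (innerSL ℝ (p : V))) ((GU p).inverse (innerSL ℝ (p : V)))
    by_contra hq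
    rw [not_le] at hq
    have hq0 : 0 ≤ q ∨ q < 0 := le_or_gt 0 q
    have hApos : 0 ≤ GU (p : V) (A (p : V)) (A (p : V)) := by
      have := hgU p (A (p : V))
      by_cases h0 : A (p : V) = 0
      · rw [h0]; simp
      · have h7 := hgU p (A (p : V)) h0
        rw [hG p] at h7
        exact h7.le
    nlinarith
  /- ── (8) assembly ── -/
  refine ⟨U, gU, GU, ⟨0, hUball (mem_ball_self (by norm_num))⟩, A, lam, hG, hgU, hUball, hΦAs,
    hΦAinj, hdΦAinj, fun y hy u w ↦ hval ⟨y, hy⟩ u w, hq1, hlam0, hlamle, hΓ, ?_⟩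
  intro x₁ hx₁
  refine ⟨A (x₁ • ε₀), ?_, ?_⟩
  · have hAx : A (x₁ • ε₀) = (2 * x₁) • ε₀ := by
      rw [hA, inner_smul_unit_self hε₀, sub_self, smul_zero, add_zero, smul_smul]
    rw [mem_closedBall, dist_zero_right, hAx, norm_smul, Real.norm_eq_abs, hε₀, mul_one, abs_le]
    constructor <;> linarith [hx₁.1, hx₁.2]
  · show Φ (A.symm (A (x₁ • ε₀))) = c x₁
    rw [A.symm_apply_apply, hax]

end RoundModel

end Literature.Geometry.Riemannian

end
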